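import Mathlib
import Summits.MatrixMultiplication.MatrixMultiplication.Theorems.SoloBlindCorankLeThree
import Summits.MatrixMultiplication.MatrixMultiplication.Theorems.SoloBlindTypeModelTwo

/-!
# Solo-blind seat (MatrixMultiplication), s85 — (K₃) and Conjecture E at corank at most four (paper/KraftK3.md Q-K80)

COMPUTATIONAL FILE (kernel evaluation by `native_decide`; propose with `--computational`).
The four-point certificate: every proper two-sided CANONICAL family of bitmasks over four outside points is
accepted by the version-two oracle in both modes at scale `soloBlindScale` (`soloBlindCertCanon 4 8 i`, eight
chunks by the residue of the family code).  Since some relabelling of the outside points makes the exact presence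
family canonical (`soloBlind_exists_canon`) and relabelling does not change the set `B ∪ X`, the type model over
the version-two checker gives the handlers for `|X| = 4`; `|X| ≤ 3` is `SoloBlindCorankLeThree`.  With the presence
reduction: `soloBlind_kraft_corank_le_four` and `soloBlind_conjE_corank_le_four` — for `h` zero-sum free on `S` in
an exponent-three group, `B ⊆ S` subset-sum-distinct (e.g. a basis) and `|S \ B| ≤ 4`, every target has
`K(τ; S) ≤ 1`, and every H-good target has `E(τ; S) ≤ 1/2`.  Nothing here bears on `ω`.
-/

namespace Summit.MatrixMultiplication.MatrixMultiplication.Theorems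

open Finset Module

variable {G : Type*} [AddCommGroup G] [DecidableEq G] {ι : Type*} [DecidableEq ι]

/-! ## The certificate over canonical families -/

/-- Chunk `i` of `n` of the `m`-point certificate: every proper two-sided canonical family whose code is
`≡ i (mod n)` passes the version-two oracle in both modes at scale `soloBlindScale`. -/
def soloBlindCertCanon (m n i : ℕ) : Bool :=
  let T := soloBlindMkTabs m
  let P := soloBlindPermTabs m
  (List.range (2 ^ m)).sublists.all fun F =>
    !(soloBlindProperB m F && soloBlindTwoSidedB m F && decide (soloBlindFamCode F % n = i) &&
        soloBlindCanonB m P F) ||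
      (soloBlindFamCheckTwo T m soloBlindScale F false true &&
        soloBlindFamCheckTwo T m soloBlindScale F true true)

/-- Extraction from a complete set of chunks: a proper two-sided canonical sub-family of `range (2^m)`
passes both checks. -/
theorem soloBlind_certCanon_extract {m n : ℕ} (hn : 0 < n) (h : ∀ i < n, soloBlindCertCanon m n i = true)
    {F : List ℕ} (hsub : F.Sublist (List.range (2 ^ m))) (hprop : ∃ M < 2 ^ m, M ∉ F)
    (hts : ∀ a < m, (∃ M ∈ F, M.testBit a = true) ∧ (∃ M ∈ F, M.testBit a = false))
    (hcanon : soloBlindCanonB m (soloBlindPermTabs m) F = true) :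
    soloBlindFamCheckTwo (soloBlindMkTabs m) m soloBlindScale F false true = true ∧
      soloBlindFamCheckTwo (soloBlindMkTabs m) m soloBlindScale F true true = true := by
  have hc := h _ (Nat.mod_lt (soloBlindFamCode F) hn)
  unfold soloBlindCertCanon at hc
  rw [List.all_eq_true] at hc
  have hF := hc F (List.mem_sublists.mpr hsub)
  have hp : soloBlindProperB m F = true := by
    unfold soloBlindProperB
    obtain ⟨M, hM, hMF⟩ := hprop
    rw [Bool.not_eq_true', Bool.eq_false_iff, Ne, List.all_eq_true]
    intro hall
    exact hMF (List.mem_of_elem_eq_true (hall M (List.mem_range.mpr hM)))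
  have ht : soloBlindTwoSidedB m F = true := by
    unfold soloBlindTwoSidedB
    rw [List.all_eq_true]
    intro a ha
    rw [List.mem_range] at ha
    obtain ⟨⟨M, hM, hMa⟩, ⟨M', hM', hM'a⟩⟩ := hts a ha
    rw [Bool.and_eq_true, List.any_eq_true, List.any_eq_true]
    exact ⟨⟨M, hM, hMa⟩, ⟨M', hM', by simp [hM'a]⟩⟩
  simpa [hp, ht, hcanon] using hF

omit [DecidableEq ι] in
/-- The exact presence family of a two-sided proper target is proper and two-sided as a family of masks. -/
theorem soloBlind_exactFam_properTwoSided {h : ι → G} {B : Finset ι} {m : ℕ} (x : Fin m ↪ ι) {τ : G}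
    (hts : soloBlindTwoSidedProper h B (Finset.univ.map x) τ) :
    (∃ M < 2 ^ m, M ∉ soloBlindExactFam h B x τ) ∧
      ∀ a < m, (∃ M ∈ soloBlindExactFam h B x τ, M.testBit a = true) ∧
        (∃ M ∈ soloBlindExactFam h B x τ, M.testBit a = false) := by
  constructor
  · obtain ⟨C, hC, hnp⟩ := hts.1
    obtain ⟨M, hM, rfl⟩ := soloBlind_exists_mask x hC
    exact ⟨M, hM, fun hmem => hnp
      ((soloBlind_present_map_iff h B x τ M).mpr (soloBlind_mem_exactFam.mp hmem).2)⟩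
  · intro a ha
    obtain ⟨⟨C₁, hC₁, hx₁, hp₁⟩, ⟨C₂, hC₂, hx₂, hp₂⟩⟩ :=
      hts.2 (x ⟨a, ha⟩) (Finset.mem_map_of_mem x (Finset.mem_univ _))
    obtain ⟨M₁, hM₁, rfl⟩ := soloBlind_exists_mask x hC₁
    obtain ⟨M₂, hM₂, rfl⟩ := soloBlind_exists_mask x hC₂
    rw [Finset.mem_map' x] at hx₁ hx₂
    exact ⟨⟨M₁, soloBlind_mem_exactFam.mpr ⟨hM₁, (soloBlind_present_map_iff h B x τ M₁).mp hp₁⟩,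
        (soloBlind_mem_decSet ⟨a, ha⟩).mp hx₁⟩,
      ⟨M₂, soloBlind_mem_exactFam.mpr ⟨hM₂, (soloBlind_present_map_iff h B x τ M₂).mp hp₂⟩,
        Bool.eq_false_iff.mpr fun ht => hx₂ ((soloBlind_mem_decSet ⟨a, ha⟩).mpr ht)⟩⟩

/-! ## Kernel evaluation of the four-point certificate -/

/-- Chunk 0 of the four-point certificate. -/
theorem soloBlind_certCanon_four_0 : soloBlindCertCanon 4 8 0 = true := by native_decide

/-- Chunk 1 of the four-point certificate. -/
theorem soloBlind_certCanon_four_1 : soloBlindCertCanon 4 8 1 = true := by native_decide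

/-- Chunk 2 of the four-point certificate. -/
theorem soloBlind_certCanon_four_2 : soloBlindCertCanon 4 8 2 = true := by native_decide

/-- Chunk 3 of the four-point certificate. -/
theorem soloBlind_certCanon_four_3 : soloBlindCertCanon 4 8 3 = true := by native_decide

/-- Chunk 4 of the four-point certificate. -/
theorem soloBlind_certCanon_four_4 : soloBlindCertCanon 4 8 4 = true := by native_decide

/-- Chunk 5 of the four-point certificate. -/
theorem soloBlind_certCanon_four_5 : soloBlindCertCanon 4 8 5 = true := by native_decide

/-- Chunk 6 of the four-point certificate. -/
theorem soloBlind_certCanon_four_6 : soloBlindCertCanon 4 8 6 = true := by native_decide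

/-- Chunk 7 of the four-point certificate. -/
theorem soloBlind_certCanon_four_7 : soloBlindCertCanon 4 8 7 = true := by native_decide

/-- THE FOUR-POINT CERTIFICATE, all chunks. -/
theorem soloBlind_certCanon_four : ∀ i < 8, soloBlindCertCanon 4 8 i = true := by
  intro i hi
  interval_cases i
  exacts [soloBlind_certCanon_four_0, soloBlind_certCanon_four_1, soloBlind_certCanon_four_2,
    soloBlind_certCanon_four_3, soloBlind_certCanon_four_4, soloBlind_certCanon_four_5,
    soloBlind_certCanon_four_6, soloBlind_certCanon_four_7]

/-! ## Handlers and the corank-four theorems -/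

omit [DecidableEq ι] in
/-- CERTIFIED ACCEPTANCE (`m = 4`): after a suitable relabelling of the four outside points, the exact
presence family of a two-sided proper target is accepted by the version-two oracle in both modes. -/
theorem soloBlind_exactFam_checksFour {h : ι → G} {B : Finset ι} (x : Fin 4 ↪ ι) {τ : G}
    (hts : soloBlindTwoSidedProper h B (Finset.univ.map x) τ) :
    ∃ π : Equiv.Perm (Fin 4),
      soloBlindFamCheckTwo (soloBlindMkTabs 4) 4 soloBlindScale
          (soloBlindExactFam h B (π.toEmbedding.trans x) τ) false true = true ∧
        soloBlindFamCheckTwo (soloBlindMkTabs 4) 4 soloBlindScale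
          (soloBlindExactFam h B (π.toEmbedding.trans x) τ) true true = true := by
  obtain ⟨π, hπ⟩ := soloBlind_exists_canon 4 (soloBlindExactFam h B x τ)
  refine ⟨π, ?_⟩
  have hts' : soloBlindTwoSidedProper h B (Finset.univ.map (π.toEmbedding.trans x)) τ := by
    rwa [soloBlind_map_perm_enum]
  obtain ⟨hprop, hts2⟩ := soloBlind_exactFam_properTwoSided (π.toEmbedding.trans x) hts'
  rw [soloBlindExactFam_perm] at hprop hts2 ⊢
  exact soloBlind_certCanon_extract (by norm_num) soloBlind_certCanon_four
    (soloBlindPermFam_sublist 4 π _) hprop hts2 hπ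

/-- ENUMERATED HANDLER, mode K (`m ≤ 4` outside points). -/
theorem soloBlind_enum_kraft (three : ∀ g : G, g + g + g = 0) {h : ι → G} {B : Finset ι}
    (hdist : ∀ A ⊆ B, ∀ A' ⊆ B, ∑ i ∈ A, h i = ∑ i ∈ A', h i → A = A')
    {m : ℕ} (hm : m ≤ 4) (x : Fin m ↪ ι) (hxB : ∀ a, x a ∉ B)
    (zsf : ∀ T ⊆ B ∪ Finset.univ.map x, T.Nonempty → ∑ i ∈ T, h i ≠ 0) {τ : G}
    (hts : soloBlindTwoSidedProper h B (Finset.univ.map x) τ) :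
    soloBlindMass h (B ∪ Finset.univ.map x) τ ≤ 1 := by
  letI : Module (ZMod 3) G := AddCommGroup.zmodModule (soloBlind_three_nsmul_of_add three)
  have hli : LinearIndependent (ZMod 3) (fun i : B => h i) :=
    soloBlind_linearIndependent_of_subsetSum_inj h B hdist
  rcases Nat.lt_or_ge m 4 with hlt | hge
  · obtain ⟨hK, -⟩ := soloBlind_exactFam_checks (by omega) x hts
    exact soloBlind_typeModel_kraft hli hdist x hxB τ soloBlindScale zsf hK
  · obtain rfl : m = 4 := le_antisymm hm hge
    obtain ⟨π, hK, -⟩ := soloBlind_exactFam_checksFour x hts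
    have e := soloBlind_typeModelTwo_kraft hli hdist (π.toEmbedding.trans x) (fun a => hxB (π a)) τ
      soloBlindScale (by rwa [soloBlind_map_perm_enum]) hK
    rwa [soloBlind_map_perm_enum] at e

/-- ENUMERATED HANDLER, mode E (`m ≤ 4` outside points). -/
theorem soloBlind_enum_conjE (three : ∀ g : G, g + g + g = 0) {h : ι → G} {B : Finset ι}
    (hdist : ∀ A ⊆ B, ∀ A' ⊆ B, ∑ i ∈ A, h i = ∑ i ∈ A', h i → A = A')
    {m : ℕ} (hm : m ≤ 4) (x : Fin m ↪ ι) (hxB : ∀ a, x a ∉ B)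
    (zsf : ∀ T ⊆ B ∪ Finset.univ.map x, T.Nonempty → ∑ i ∈ T, h i ≠ 0) {τ : G}
    (hgood : ∀ T ⊆ B ∪ Finset.univ.map x, ∑ i ∈ T, h i ≠ τ + τ)
    (hts : soloBlindTwoSidedProper h B (Finset.univ.map x) τ) :
    soloBlindMass h (B ∪ Finset.univ.map x) τ ≤ 1 / 2 := by
  letI : Module (ZMod 3) G := AddCommGroup.zmodModule (soloBlind_three_nsmul_of_add three)
  have hli : LinearIndependent (ZMod 3) (fun i : B => h i) :=
    soloBlind_linearIndependent_of_subsetSum_inj h B hdist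
  rcases Nat.lt_or_ge m 4 with hlt | hge
  · obtain ⟨-, hE⟩ := soloBlind_exactFam_checks (by omega) x hts
    exact soloBlind_typeModel_conjE hli hdist x hxB τ (by decide) zsf hgood hE
  · obtain rfl : m = 4 := le_antisymm hm hge
    obtain ⟨π, -, hE⟩ := soloBlind_exactFam_checksFour x hts
    have e := soloBlind_typeModelTwo_conjE hli hdist (π.toEmbedding.trans x) (fun a => hxB (π a)) τ
      (show 1 ≤ soloBlindScale by decide) (by rwa [soloBlind_map_perm_enum])
      (by rwa [soloBlind_map_perm_enum]) hE
    rwa [soloBlind_map_perm_enum] at e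

/-- HANDLER, mode K: a two-sided proper target over at most four outside points has mass `≤ 1`. -/
theorem soloBlind_handler_kraft_four (three : ∀ g : G, g + g + g = 0) {h : ι → G} {B X : Finset ι}
    (hdist : ∀ A ⊆ B, ∀ A' ⊆ B, ∑ i ∈ A, h i = ∑ i ∈ A', h i → A = A')
    (hXB : Disjoint B X) (hX : X.card ≤ 4)
    (zsf : ∀ T ⊆ B ∪ X, T.Nonempty → ∑ i ∈ T, h i ≠ 0) {τ : G}
    (hts : soloBlindTwoSidedProper h B X τ) : soloBlindMass h (B ∪ X) τ ≤ 1 := by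
  obtain ⟨x, hx⟩ := soloBlind_exists_enum X
  have hxB : ∀ a, x a ∉ B := fun a ha => by
    have hxa : x a ∈ Finset.univ.map x := Finset.mem_map_of_mem x (Finset.mem_univ a)
    rw [hx] at hxa
    exact Finset.disjoint_left.mp hXB ha hxa
  rw [← hx] at zsf hts ⊢
  exact soloBlind_enum_kraft three hdist hX x hxB zsf hts

/-- HANDLER, mode E: an H-good two-sided proper target over at most four outside points has mass
`≤ 1/2`. -/
theorem soloBlind_handler_conjE_four (three : ∀ g : G, g + g + g = 0) {h : ι → G} {B X : Finset ι}
    (hdist : ∀ A ⊆ B, ∀ A' ⊆ B, ∑ i ∈ A, h i = ∑ i ∈ A', h i → A = A')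
    (hXB : Disjoint B X) (hX : X.card ≤ 4)
    (zsf : ∀ T ⊆ B ∪ X, T.Nonempty → ∑ i ∈ T, h i ≠ 0) {τ : G}
    (hgood : ∀ T ⊆ B ∪ X, ∑ i ∈ T, h i ≠ τ + τ)
    (hts : soloBlindTwoSidedProper h B X τ) : soloBlindMass h (B ∪ X) τ ≤ 1 / 2 := by
  obtain ⟨x, hx⟩ := soloBlind_exists_enum X
  have hxB : ∀ a, x a ∉ B := fun a ha => by
    have hxa : x a ∈ Finset.univ.map x := Finset.mem_map_of_mem x (Finset.mem_univ a)
    rw [hx] at hxa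
    exact Finset.disjoint_left.mp hXB ha hxa
  rw [← hx] at zsf hgood hts ⊢
  exact soloBlind_enum_conjE three hdist hX x hxB zsf hgood hts

/-- (K₃) AT CORANK AT MOST FOUR (every rank, exponent `3`): `B ⊆ S` subset-sum-distinct with
`|S \\ B| ≤ 4` and `h` zero-sum free on `S` ⟹ `K(τ; S) ≤ 1` for every `τ`. -/
theorem soloBlind_kraft_corank_le_four (three : ∀ g : G, g + g + g = 0) {h : ι → G} {S B : Finset ι}
    (hBS : B ⊆ S) (hc : (S \ B).card ≤ 4)
    (hdist : ∀ A ⊆ B, ∀ A' ⊆ B, ∑ i ∈ A, h i = ∑ i ∈ A', h i → A = A')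
    (zsf : ∀ T ⊆ S, T.Nonempty → ∑ i ∈ T, h i ≠ 0) (τ : G) : soloBlindMass h S τ ≤ 1 := by
  have hS : B ∪ S \ B = S := Finset.union_sdiff_of_subset hBS
  rw [← hS] at zsf ⊢
  exact soloBlind_kraft_reduction three hdist (S \ B) Finset.disjoint_sdiff zsf
    (fun X' hX' τ' hts => soloBlind_handler_kraft_four three hdist
      (Finset.disjoint_of_subset_right hX' Finset.disjoint_sdiff)
      (le_trans (Finset.card_le_card hX') hc)
      (fun T hT hne => zsf T (hT.trans (Finset.union_subset_union (le_refl B) hX')) hne) hts) τ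

/-- CONJECTURE E AT CORANK AT MOST FOUR (every rank, exponent `3`): `B ⊆ S` subset-sum-distinct with
`|S \\ B| ≤ 4`, `h` zero-sum free on `S`, `τ` H-good on `S` ⟹ `E(τ; S) ≤ 1/2`. -/
theorem soloBlind_conjE_corank_le_four (three : ∀ g : G, g + g + g = 0) {h : ι → G} {S B : Finset ι}
    (hBS : B ⊆ S) (hc : (S \ B).card ≤ 4)
    (hdist : ∀ A ⊆ B, ∀ A' ⊆ B, ∑ i ∈ A, h i = ∑ i ∈ A', h i → A = A')
    (zsf : ∀ T ⊆ S, T.Nonempty → ∑ i ∈ T, h i ≠ 0) {τ : G} (hgood : ∀ T ⊆ S, ∑ i ∈ T, h i ≠ τ + τ) :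
    soloBlindMass h S τ ≤ 1 / 2 := by
  have hS : B ∪ S \ B = S := Finset.union_sdiff_of_subset hBS
  rw [← hS] at zsf hgood ⊢
  exact soloBlind_conjE_reduction three hdist (S \ B) Finset.disjoint_sdiff zsf hgood
    (fun X' hX' τ' hts => soloBlind_handler_kraft_four three hdist
      (Finset.disjoint_of_subset_right hX' Finset.disjoint_sdiff)
      (le_trans (Finset.card_le_card hX') hc)
      (fun T hT hne => zsf T (hT.trans (Finset.union_subset_union (le_refl B) hX')) hne) hts)
    (fun X' hX' hts => soloBlind_handler_conjE_four three hdist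
      (Finset.disjoint_of_subset_right hX' Finset.disjoint_sdiff)
      (le_trans (Finset.card_le_card hX') hc)
      (fun T hT hne => zsf T (hT.trans (Finset.union_subset_union (le_refl B) hX')) hne)
      (fun T hT => hgood T (hT.trans (Finset.union_subset_union (le_refl B) hX'))) hts)

end Summit.MatrixMultiplication.MatrixMultiplication.Theorems
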